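import Literature.NumberTheory.EllipticCurves.TorsionGaloisRepMatrixProofs
import Literature.NumberTheory.GaloisRepresentations.GL2ModEightFullImageProofs
import Literature.NumberTheory.EllipticCurves.TwoAdicImageSurjectivityModTwoProofs
import HarnessLib

/-!
# `K(E[8]) ⊃ K(√Δ, √-1, √2)`: the Galois action on `ζ₈ = e₈(P₀, Q₀)`, `√±2` and `√Δ` through `ρ̄_{E,8}` (proofs only)

`Proofs`-style file (theorems and bookkeeping abbreviations only; no named fact, no instance;
D-0014/D-0026), second layer of the kernel proof of T. Dokchitser, V. Dokchitser, *Surjectivity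
of mod `2ⁿ` representations of elliptic curves*, Math. Z. 272 (2012) 961–964, Theorem, clause (3)
(`TwoAdicImageSurjectivityModEightProofs`).  The printed proof: "by the properties of the Weil
pairing, `ℚ(E[n]) ⊃ ℚ(ζₙ)` and the corresponding map `Gal(ℚ(E[n])/ℚ) ↠ (ℤ/nℤ)^×` is simply the
determinant.  In particular `ℚ(E[8]) ⊃ ℚ(√Δ, √-1, √2)`."  Here, for an elliptic curve `W` over a
field `K` with `2 ≠ 0` and a frame `e : E[8] ≃+ (ℤ/8)²` (basis `P₀ = e⁻¹δ₀`, `Q₀ = e⁻¹δ₁`):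

* §1 `ζ = e₈(P₀, Q₀)` (the tree's PROVED Weil pairing `WeierstrassCurve.weilPairingFun`,
  Silverman *AEC* III.8) satisfies `ζ⁸ = 1`, `σζ = ζ^{det ρ̄₈(σ)}` (`smul_zeta`, the determinant
  statement, from `pairing_generators_eq_pow`), and `ζ⁴ = -1` (non-degeneracy); hence
  `√2 := ζ + ζ⁷`, `√-2 := ζ + ζ³` have squares `2`, `-2`, and `σ√2 = ±√2`, `σ√-2 = ±√-2` with the
  signs `χ₂(det)`, `χ₋₂(det)` (`smul_sqrtTwo`, `smul_sqrtNegTwo`; additive characters `c2`,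
  `c2 + cm1` of `GL2ModEightSignData`);
* §2 `σδ = sgn(ρ̄₈(σ) mod 2) · δ` for the `δ` with `Δ = 16δ²` of `TwoTorsionGaloisActionProofs`
  (`smul_delta_eq`): the sign of the permutation of `{T₀, T₁, T₂} = {4P₀, 4Q₀, 4(P₀+Q₀)}` is read off
  from the number of fixed letters, i.e. of nonzero vectors of `𝔽₂²` fixed by `ρ̄₈(σ) mod 2`;
* §3 the four witnesses: `√2`, `√-2`, `√2·δ`, `√-2·δ` are each moved by some `σ` as soon as
  `2`, `-2`, `2Δ = 2(4δ)²`, `-2Δ` are non-squares in `K` (`K` perfect: `K̄^{Γ_K} = K`), in the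
  currency of `GL2Mod8.surjective_of_liftsModFour`; and conversely the elements with matrices
  `diag(1,3)`, `diag(1,5)` move `√2·δ`, `√-2·δ` (`not_isSquare_two_mul_Δ_of_matrix`, `…neg_two…`).

## References

* [DokchitserDokchitserMathZ2012] T. Dokchitser, V. Dokchitser, Math. Z. 272 (2012) 961–964,
  proof of the Theorem, clause (3). [corpus:paper:arxiv-1104.5031 p0001 L58–L98]
* [SilvermanAEC2009] J. H. Silverman, *The Arithmetic of Elliptic Curves*, 2nd ed., GTM 106
  (2009), III.8 (Weil pairing: Prop. 8.1, Cor. 8.1.1 `e_m(P₀,Q₀)` primitive), III.7, VIII.1.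
-/

set_option autoImplicit false

noncomputable section

open scoped Classical

open Matrix WeierstrassCurve

namespace Literature.NumberTheory.EllipticCurves.DokchitserDokchitser2012

open Literature.NumberTheory.GaloisRepresentations.GL2Mod8

universe u

variable {K : Type u} [Field K] (W : WeierstrassCurve K) [W.IsElliptic]

/-- `8 ≠ 0` in `K` when `2 ≠ 0`. [folklore] -/
private theorem eight_ne_zero (h2 : (2 : K) ≠ 0) : ((8 : ℕ) : K) ≠ 0 := by
  rw [show ((8 : ℕ) : K) = 2 ^ 3 by norm_num]
  exact pow_ne_zero 3 h2

variable (h2 : (2 : K) ≠ 0)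

/-- A frame `E[8] ≅ (ℤ/8)²` (Silverman, *AEC*, Cor. III.6.4(b); tree theorem
`nonempty_geomTorsion_addEquiv_fin_two`). [folklore] -/
def frame8 : geomTorsion W 8 ≃+ (Fin 2 → ZMod 8) :=
  (nonempty_geomTorsion_addEquiv_fin_two W (m := 8) (eight_ne_zero h2)).some

/-- The basis point `P₀ = e⁻¹δ₀` of `E[8]` (bookkeeping). [folklore] -/
abbrev P0 : geomTorsion W 8 := (frame8 W h2).symm (Pi.single 0 1)

/-- The basis point `Q₀ = e⁻¹δ₁` of `E[8]` (bookkeeping). [folklore] -/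
abbrev Q0 : geomTorsion W 8 := (frame8 W h2).symm (Pi.single 1 1)

/-- `ρ̄_{E,8}(σ)` as a matrix in the frame (bookkeeping abbreviation for `rhoMat`). [folklore] -/
abbrev M (σ : Field.absoluteGaloisGroup K) : M8 := rhoMat W (frame8 W h2) σ

/-! ### §1. `ζ = e₈(P₀, Q₀)`: `σζ = ζ^{det}`, `ζ⁴ = -1`, `√2 = ζ + ζ⁷`, `√-2 = ζ + ζ³` -/

/-- `ζ = e₈(P₀, Q₀) ∈ K̄`, the Weil pairing of the frame's basis (Silverman, *AEC*, III.8).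
[folklore] -/
def zeta : AlgebraicClosure K :=
  weilPairingFun (eight_ne_zero h2) (P0 W h2 : geomPoints W) (Q0 W h2 : geomPoints W)

/-- The Weil pairing restricted to `E[8]`, as a pairing on the subgroup (bookkeeping). [folklore] -/
private abbrev e8 (S T : geomTorsion W 8) : AlgebraicClosure K :=
  weilPairingFun (eight_ne_zero h2) (S : geomPoints W) (T : geomPoints W)

/-- `e₈` on `E[8]` takes values in `μ₈` and is biadditive and alternating (Silverman, *AEC*,
Prop. III.8.1 (a),(b); tree theorems `weilPairingFun_pow/_add_left/_add_right/_self`).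
[cite: SilvermanAEC2009, Prop. III.8.1 (a)–(b)] -/
theorem e8_props :
    (∀ S T, e8 W h2 S T ^ 8 = 1) ∧ (∀ S₁ S₂ T, e8 W h2 (S₁ + S₂) T = e8 W h2 S₁ T * e8 W h2 S₂ T) ∧
      (∀ S T₁ T₂, e8 W h2 S (T₁ + T₂) = e8 W h2 S T₁ * e8 W h2 S T₂) ∧ ∀ T, e8 W h2 T T = 1 := by
  have mem := zsmul_coe_geomTorsion (W := W) (m := 8)
  exact ⟨fun S T ↦ weilPairingFun_pow _ (mem S) (mem T),
    fun S₁ S₂ T ↦ weilPairingFun_add_left _ (mem S₁) (mem S₂) (mem T),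
    fun S T₁ T₂ ↦ weilPairingFun_add_right _ (mem S) (mem T₁) (mem T₂),
    fun T ↦ weilPairingFun_self _ (mem T)⟩

/-- `ζ⁸ = 1`. [cite: SilvermanAEC2009, Prop. III.8.1 (e_m takes values in μ_m)] -/
theorem zeta_pow_eight : zeta W h2 ^ 8 = 1 := (e8_props W h2).1 _ _

/-- An element of `E[8]` in the basis: `X = (eX)₀ P₀ + (eX)₁ Q₀`.
[cite: SilvermanAEC2009, Cor. III.6.4(b) (E[m] ≅ ℤ/mℤ × ℤ/mℤ)] -/
theorem eq_P0_Q0 (X : geomTorsion W 8) :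
    X = (frame8 W h2 X 0).val • P0 W h2 + (frame8 W h2 X 1).val • Q0 W h2 :=
  eq_nsmul_add_nsmul (frame8 W h2) X

/-- `e₈(aP₀ + cQ₀, bP₀ + dQ₀) = ζ^{ad + 7bc}`. [cite: SilvermanAEC2009, Prop. III.8.1 (bilinear, alternating)] -/
theorem e8_eq_zeta_pow (a b c d : ℕ) :
    e8 W h2 (a • P0 W h2 + c • Q0 W h2) (b • P0 W h2 + d • Q0 W h2) =
      zeta W h2 ^ (a * d + 7 * (b * c)) := by
  obtain ⟨hμ, hadd₁, hadd₂, halt⟩ := e8_props W h2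
  exact pairing_generators_eq_pow hμ hadd₁ hadd₂ halt (by norm_num) _ _ a c b d

/-- Powers of `ζ` only depend on the exponent modulo `8`. [folklore] -/
private theorem zeta_pow_mod (n : ℕ) : zeta W h2 ^ n = zeta W h2 ^ (n % 8) := by
  conv_lhs => rw [← Nat.div_add_mod n 8, pow_add, pow_mul, zeta_pow_eight, one_pow, one_mul]

/-- **The determinant statement**: `σζ = ζ^{det ρ̄₈(σ)}` ("`Gal(K(E[n])/K) → (ℤ/nℤ)^×` is simply the
determinant": `σζ = e₈(σP₀, σQ₀) = ζ^{ad - bc}` by Galois equivariance, bilinearity and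
alternation). [cite: DokchitserDokchitserMathZ2012, proof of the Theorem (Weil pairing: the map to (ℤ/nℤ)^× is the determinant)] -/
theorem smul_zeta (σ : Field.absoluteGaloisGroup K) :
    σ • zeta W h2 = zeta W h2 ^ ((M W h2 σ).det).val := by
  have mem := zsmul_coe_geomTorsion (W := W) (m := 8)
  have hP := eq_P0_Q0 W h2 (σ • P0 W h2)
  have hQ := eq_P0_Q0 W h2 (σ • Q0 W h2)
  have hcol : ∀ j i, frame8 W h2 (σ • (frame8 W h2).symm (Pi.single j 1)) i = M W h2 σ i j := by
    intro j i
    rw [rhoMat_mulVec, AddEquiv.apply_symm_apply]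
    simp [Matrix.mulVec, dotProduct, Pi.single_apply]
  rw [hcol 0 0, hcol 0 1] at hP
  rw [hcol 1 0, hcol 1 1] at hQ
  have lhs : σ • zeta W h2 = e8 W h2 (σ • P0 W h2) (σ • Q0 W h2) := by
    rw [zeta, ← weilPairingFun_smul _ σ (mem _) (mem _)]
    rfl
  rw [lhs, hP, hQ, e8_eq_zeta_pow, zeta_pow_mod, zeta_pow_mod W h2 (M W h2 σ).det.val]
  congr 1
  rw [Matrix.det_fin_two, ← ZMod.val_natCast, ← ZMod.val_natCast]
  congr 1
  push_cast
  rw [ZMod.natCast_zmod_val, ZMod.natCast_zmod_val, ZMod.natCast_zmod_val, ZMod.natCast_zmod_val,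
    ZMod.natCast_zmod_val, show (7 : ZMod 8) = -1 by decide]
  ring

/-- **`ζ⁴ = -1`** (`ζ = e₈(P₀, Q₀)` is a primitive eighth root of unity: if `ζ⁴ = 1` then `4P₀ ≠ O`
would pair trivially with all of `E[8]`, contradicting non-degeneracy; Silverman, *AEC*,
Cor. III.8.1.1). [cite: SilvermanAEC2009, Cor. III.8.1.1] -/
theorem zeta_pow_four : zeta W h2 ^ 4 = -1 := by
  have mem := zsmul_coe_geomTorsion (W := W) (m := 8)
  have h8 : (zeta W h2 ^ 4) * (zeta W h2 ^ 4) = 1 := by rw [← pow_add]; exact zeta_pow_eight W h2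
  rcases mul_self_eq_one_iff.mp h8 with h | h
  · exfalso
    -- `4P₀` pairs trivially with every `T = bP₀ + dQ₀`: `e₈(4P₀, T) = ζ^{4d}`
    have htriv : ∀ T : geomPoints W, ((8 : ℕ) : ℤ) • T = 0 →
        weilPairingFun (eight_ne_zero h2) ((4 • P0 W h2 : geomTorsion W 8) : geomPoints W) T = 1 := by
      intro T hT
      set T' : geomTorsion W 8 := ⟨T, (mem_torsionPoints_iff _ _ T).mpr hT⟩
      have hT' := eq_P0_Q0 W h2 T'
      have : T = (T' : geomPoints W) := rfl
      rw [this, hT', show (4 • P0 W h2 : geomTorsion W 8) = 4 • P0 W h2 + 0 • Q0 W h2 by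
        rw [zero_nsmul, add_zero]]
      change e8 W h2 _ _ = 1
      rw [e8_eq_zeta_pow, mul_zero, mul_zero, add_zero, pow_mul, h, one_pow]
    have h0 := eq_zero_of_weilPairingFun_eq_one_left (eight_ne_zero h2) (mem _) htriv
    have h4 : (4 • P0 W h2 : geomTorsion W 8) = 0 := Subtype.ext h0
    have := congrArg (frame8 W h2) h4
    rw [map_nsmul, AddEquiv.apply_symm_apply, map_zero] at this
    have h5 := congr_fun this 0
    simp [nsmul_eq_mul] at h5
    exact absurd h5 (by decide)
  · exact h

/-- `ζ^{n+4} = -ζⁿ`. [folklore] -/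
private theorem zeta_pow_add_four (n : ℕ) : zeta W h2 ^ (n + 4) = -zeta W h2 ^ n := by
  rw [pow_add, zeta_pow_four, mul_neg_one]

/-- `ζ⁵ = -ζ`, `ζ⁷ = -ζ³`. [folklore] -/
private theorem zeta_pow_five : zeta W h2 ^ 5 = -zeta W h2 := by
  rw [show (5 : ℕ) = 1 + 4 from rfl, zeta_pow_add_four, pow_one]

/-- `ζ⁷ = -ζ³`. [folklore] -/
private theorem zeta_pow_seven : zeta W h2 ^ 7 = -zeta W h2 ^ 3 := zeta_pow_add_four W h2 3

/-- `√2 := ζ + ζ⁷ = ζ + ζ⁻¹` (bookkeeping). [folklore] -/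
def sqrtTwo : AlgebraicClosure K := zeta W h2 + zeta W h2 ^ 7

/-- `√-2 := ζ + ζ³` (bookkeeping). [folklore] -/
def sqrtNegTwo : AlgebraicClosure K := zeta W h2 + zeta W h2 ^ 3

/-- `(ζ + ζ⁷)² = 2`. [cite: DokchitserDokchitserMathZ2012, proof of the Theorem (ℚ(E[8]) ⊃ ℚ(√2))] -/
theorem sqrtTwo_sq : sqrtTwo W h2 * sqrtTwo W h2 = 2 := by
  have h14 : zeta W h2 ^ 14 = -zeta W h2 ^ 2 := by
    rw [zeta_pow_mod, show 14 % 8 = 2 + 4 from rfl, zeta_pow_add_four]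
  have h8 := zeta_pow_eight W h2
  have e : sqrtTwo W h2 * sqrtTwo W h2 = zeta W h2 ^ 2 + 2 * zeta W h2 ^ 8 + zeta W h2 ^ 14 := by
    rw [sqrtTwo]; ring
  rw [e, h8, h14]; ring

/-- `(ζ + ζ³)² = -2`. [cite: DokchitserDokchitserMathZ2012, proof of the Theorem (ℚ(E[8]) ⊃ ℚ(√-1, √2))] -/
theorem sqrtNegTwo_sq : sqrtNegTwo W h2 * sqrtNegTwo W h2 = -2 := by
  have h6 : zeta W h2 ^ 6 = -zeta W h2 ^ 2 := zeta_pow_add_four W h2 2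
  have h4 := zeta_pow_four W h2
  have e : sqrtNegTwo W h2 * sqrtNegTwo W h2 = zeta W h2 ^ 2 + 2 * zeta W h2 ^ 4 + zeta W h2 ^ 6 := by
    rw [sqrtNegTwo]; ring
  rw [e, h4, h6]; ring

/-- `det ρ̄₈(σ)` is `1, 3, 5` or `7`. [folklore] -/
private theorem det_cases (σ : Field.absoluteGaloisGroup K) :
    (M W h2 σ).det = 1 ∨ (M W h2 σ).det = 3 ∨ (M W h2 σ).det = 5 ∨ (M W h2 σ).det = 7 :=
  eq_of_red_eq_one _ ((GaloisRepresentations.GL2Mod8.mul_self_eq_one_iff _).mp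
    (det_map_mul_self (rhoMat W (frame8 W h2)) σ))

/-- **`σ√2 = χ₂(det ρ̄₈σ) · √2`**: `σ(ζ + ζ⁻¹) = ζ^d + ζ^{-d}` is `√2` for `d ≡ ±1` and `-√2` for
`d ≡ ±3 (mod 8)`. [cite: DokchitserDokchitserMathZ2012, proof of the Theorem (ℚ(E[8]) ⊃ ℚ(√2); Gal → (ℤ/8ℤ)^× is det)] -/
theorem smul_sqrtTwo (σ : Field.absoluteGaloisGroup K) :
    σ • sqrtTwo W h2 = (sgnUnit (c2 (M W h2 σ).det) : AlgebraicClosure K) * sqrtTwo W h2 := by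
  rw [sqrtTwo, smul_add, smul_pow', smul_zeta, ← pow_mul]
  rcases det_cases W h2 σ with h | h | h | h <;> rw [h]
  · rw [show c2 1 = 0 by decide, sgnUnit_zero, show (1 : ZMod 8).val = 1 from rfl,
      zeta_pow_mod W h2 (1 * 7), show 1 * 7 % 8 = 7 from rfl]
    push_cast; ring
  · rw [show c2 3 = 1 by decide, sgnUnit_one, show (3 : ZMod 8).val = 3 from rfl,
      zeta_pow_mod W h2 (3 * 7), show 3 * 7 % 8 = 5 from rfl, zeta_pow_five, zeta_pow_seven]
    push_cast; ring
  · rw [show c2 5 = 1 by decide, sgnUnit_one, show (5 : ZMod 8).val = 5 from rfl,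
      zeta_pow_mod W h2 (5 * 7), show 5 * 7 % 8 = 3 from rfl, zeta_pow_five, zeta_pow_seven]
    push_cast; ring
  · rw [show c2 7 = 0 by decide, sgnUnit_zero, show (7 : ZMod 8).val = 7 from rfl,
      zeta_pow_mod W h2 (7 * 7), show 7 * 7 % 8 = 1 from rfl]
    push_cast; ring

/-- **`σ√-2 = χ₋₂(det ρ̄₈σ) · √-2`** (`χ₋₂ = χ₂χ₋₁`): `σ(ζ + ζ³) = ζ^d + ζ^{3d}` is `√-2` for `d ∈ {1,3}`
and `-√-2` for `d ∈ {5,7}`. [cite: DokchitserDokchitserMathZ2012, proof of the Theorem (ℚ(E[8]) ⊃ ℚ(√-1, √2); Gal → (ℤ/8ℤ)^× is det)] -/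
theorem smul_sqrtNegTwo (σ : Field.absoluteGaloisGroup K) :
    σ • sqrtNegTwo W h2 =
      (sgnUnit (c2 (M W h2 σ).det + cm1 (M W h2 σ).det) : AlgebraicClosure K) * sqrtNegTwo W h2 := by
  rw [sqrtNegTwo, smul_add, smul_pow', smul_zeta, ← pow_mul]
  rcases det_cases W h2 σ with h | h | h | h <;> rw [h]
  · rw [show c2 1 + cm1 1 = 0 by decide, sgnUnit_zero, show (1 : ZMod 8).val = 1 from rfl,
      zeta_pow_mod W h2 (1 * 3), show 1 * 3 % 8 = 3 from rfl]
    push_cast; ring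
  · rw [show c2 3 + cm1 3 = 0 by decide, sgnUnit_zero, show (3 : ZMod 8).val = 3 from rfl,
      zeta_pow_mod W h2 (3 * 3), show 3 * 3 % 8 = 1 from rfl]
    push_cast; ring
  · rw [show c2 5 + cm1 5 = 1 by decide, sgnUnit_one, show (5 : ZMod 8).val = 5 from rfl,
      zeta_pow_mod W h2 (5 * 3), show 5 * 3 % 8 = 7 from rfl, zeta_pow_five, zeta_pow_seven]
    push_cast; ring
  · rw [show c2 7 + cm1 7 = 1 by decide, sgnUnit_one, show (7 : ZMod 8).val = 7 from rfl,
      zeta_pow_mod W h2 (7 * 3), show 7 * 3 % 8 = 5 from rfl, zeta_pow_five, zeta_pow_seven]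
    push_cast; ring

/-! ### §2. `σδ = sgn(ρ̄₈(σ) mod 2) · δ` -/

/-- The three nonzero `2`-torsion points in the frame: `4P₀, 4Q₀, 4(P₀ + Q₀)` as `e⁻¹(4w_i)`,
`w = (δ₀, δ₁, δ₀ + δ₁)` (bookkeeping). [folklore] -/
abbrev wvec : Fin 3 → (Fin 2 → ZMod 8) := ![Pi.single 0 1, Pi.single 1 1, Pi.single 0 1 + Pi.single 1 1]

/-- `L_i = e⁻¹(4 w_i) ∈ E[8]` (bookkeeping). [folklore] -/
abbrev L (i : Fin 3) : geomTorsion W 8 := (frame8 W h2).symm (4 • wvec i)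

omit [W.IsElliptic] in
/-- `L_i`, as a geometric point, lies in `E[2]` and is nonzero. [cite: SilvermanAEC2009, Cor. III.6.4(b) (E[m] ≅ ℤ/mℤ × ℤ/mℤ)] -/
theorem L_mem_two (e : geomTorsion W 8 ≃+ (Fin 2 → ZMod 8)) (i : Fin 3) :
    ((e.symm (4 • wvec i) : geomTorsion W 8) : geomPoints W) ∈ geomTorsion W 2 ∧
      ((e.symm (4 • wvec i) : geomTorsion W 8) : geomPoints W) ≠ 0 := by
  constructor
  · rw [mem_geomTorsion_two_iff, ← AddSubgroup.coe_add, ← map_add, ← two_nsmul, smul_smul]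
    have : ((2 * 4) • wvec i : Fin 2 → ZMod 8) = 0 := by
      ext k; fin_cases i <;> fin_cases k <;> simp [nsmul_eq_mul] <;> decide
    rw [this, map_zero]; rfl
  · intro h
    have h' : (e.symm (4 • wvec i) : geomTorsion W 8) = 0 := Subtype.ext h
    rw [e.symm.map_eq_zero_iff] at h'
    have := congr_fun h' (if i = 1 then 1 else 0)
    fin_cases i <;> simp [nsmul_eq_mul] at this <;> exact absurd this (by decide)

/-- The letter `f i` with `T_{f i} = L_i` (`E[2] = {O, T₀, T₁, T₂}`). [folklore] -/
def letter (i : Fin 3) : Fin 3 :=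
  ((eq_zero_or_eq_T W h2 ⟨_, (L_mem_two W (frame8 W h2) i).1⟩).resolve_left
    (fun h ↦ (L_mem_two W (frame8 W h2) i).2 (congrArg Subtype.val h))).choose

/-- `T_{f i} = L_i` as geometric points. [cite: SilvermanAEC2009, Cor. III.6.4(b) (E[2] = {O, T₀, T₁, T₂})] -/
theorem coe_T_letter (i : Fin 3) :
    (T W h2 (letter W h2 i) : geomPoints W) = ((L W h2 i : geomTorsion W 8) : geomPoints W) := by
  have h := ((eq_zero_or_eq_T W h2 ⟨_, (L_mem_two W (frame8 W h2) i).1⟩).resolve_left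
    (fun h ↦ (L_mem_two W (frame8 W h2) i).2 (congrArg Subtype.val h))).choose_spec
  exact (congrArg Subtype.val h).symm

/-- `i ↦ f i` is injective (the `L_i` are distinct).
[cite: SilvermanAEC2009, Cor. III.6.4(b) (E[2] = {O, T₀, T₁, T₂})] -/
theorem letter_injective : Function.Injective (letter W h2) := by
  intro i j hij
  have h := congrArg (fun k ↦ (T W h2 k : geomPoints W)) hij
  simp only [coe_T_letter] at h
  have h' : (L W h2 i : geomTorsion W 8) = L W h2 j := Subtype.ext h
  rw [(frame8 W h2).symm.apply_eq_iff_eq] at h'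
  have h0 := congr_fun h' 0
  have h1 := congr_fun h' 1
  fin_cases i <;> fin_cases j <;> simp [nsmul_eq_mul] at h0 h1 ⊢ <;>
    first | exact absurd h0 (by decide) | exact absurd h1 (by decide)

/-- `σ` fixes the letter `f i` iff `ρ̄₈(σ) mod 2` fixes `w̄_i`: `σ L_i = e⁻¹(4 · ρ̄₈(σ) w_i)`.
[cite: SilvermanAEC2009, III.7 (the Galois action on E[2] ⊂ E[8])] -/
theorem permGal_letter_eq_iff (σ : Field.absoluteGaloisGroup K) (i : Fin 3) :
    permGal W h2 σ (letter W h2 i) = letter W h2 i ↔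
      4 • (M W h2 σ *ᵥ wvec i) = 4 • wvec i := by
  rw [← (T_injective W h2).eq_iff, T_permGal, ← Subtype.coe_inj, AddSubgroup.torsionBy.coe_smul,
    coe_T_letter, ← AddSubgroup.torsionBy.coe_smul, Subtype.coe_inj,
    ← (frame8 W h2).apply_eq_iff_eq, rhoMat_mulVec, AddEquiv.apply_symm_apply,
    Matrix.mulVec_smul]

/-- The parity labels `w̄_i` of `4P₀, 4Q₀, 4(P₀+Q₀)`, stored as the first column of a parity vector
(bookkeeping). [folklore] -/
private abbrev wbar : Fin 3 → P4 := ![(1, 0, 0, 0), (0, 0, 1, 0), (1, 0, 1, 0)]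

/-- Fixed nonzero vectors of `𝔽₂²` under a parity matrix, counted: the sign of the corresponding
permutation of the three nonzero vectors is `-1` iff exactly one is fixed, and this happens iff
`eps = 1` (kernel check over `GL₂(𝔽₂)`). [folklore] -/
private theorem eps_eq_one_iff_card (p : P4) (hp : P4.det p = 1) :
    eps p = 1 ↔ (Finset.univ.filter fun i : Fin 3 ↦
      (P4.mul p (wbar i)).1 = (wbar i).1 ∧ (P4.mul p (wbar i)).2.2.1 = (wbar i).2.2.1).card = 1 := by
  revert p; decide

/-- A permutation of three letters is odd iff it fixes exactly one letter. [folklore] -/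
private theorem sign_eq_neg_one_iff_card (q : Equiv.Perm (Fin 3)) :
    Equiv.Perm.sign q = -1 ↔ (Finset.univ.filter fun i : Fin 3 ↦ q i = i).card = 1 := by
  revert q; decide

/-- `4 • (M w) = 4 • w` in `(ℤ/8)²` is the parity statement `M̄ w̄ = w̄`; for `w = w_i` this reads on
the first column of the parity product with the matrix `(w̄_i | 0)`. [folklore] -/
private theorem four_nsmul_mulVec_eq_iff (N : M8) (i : Fin 3) :
    4 • (N *ᵥ wvec i) = 4 • wvec i ↔
      ((P4.mul (par N) (wbar i)).1 = (wbar i).1 ∧ (P4.mul (par N) (wbar i)).2.2.1 = (wbar i).2.2.1) := by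
  have key0 : ∀ x : ZMod 8, 4 * x = 0 ↔ red x = 0 := by decide
  have key1 : ∀ x : ZMod 8, 4 * x = 4 ↔ red x = 1 := by decide
  have key2 : ∀ x y : ZMod 8, 4 * x + 4 * y = 4 ↔ red x + red y = 1 := by decide
  rw [funext_iff, Fin.forall_fin_two]
  fin_cases i <;>
    simp [Matrix.mulVec, dotProduct, Fin.sum_univ_two, Pi.single_apply, nsmul_eq_mul, par, P4.mul,
      wbar, key0, key1, key2]

/-- **`σδ = sgn(ρ̄₈(σ) mod 2) · δ`**: the sign of the permutation `permGal σ` of `{T₀, T₁, T₂}`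
(`σδ = sign · δ`, `TwoTorsionGaloisActionProofs`) is the sign of `ρ̄₈(σ) mod 2 ∈ GL₂(𝔽₂) ≅ S₃`,
both being odd iff exactly one nonzero `2`-torsion point is fixed.
[cite: DokchitserDokchitserMathZ2012, proof of the Theorem (ℚ(E[2]) ⊃ ℚ(√Δ); GL₂ → S₃ is reduction mod 2)] -/
theorem smul_delta_eq (σ : Field.absoluteGaloisGroup K) :
    σ • delta W h2 = (sgnUnit (sg (M W h2 σ)) : AlgebraicClosure K) * delta W h2 := by
  rw [smul_delta]
  congr 1
  have hdet : P4.det (par (M W h2 σ)) = 1 := by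
    rw [← red_det]
    exact (GaloisRepresentations.GL2Mod8.mul_self_eq_one_iff _).mp
      (det_map_mul_self (rhoMat W (frame8 W h2)) σ)
  -- number of fixed letters = number of fixed nonzero vectors
  have hcard : (Finset.univ.filter fun j : Fin 3 ↦ permGal W h2 σ j = j).card =
      (Finset.univ.filter fun i : Fin 3 ↦ 4 • (M W h2 σ *ᵥ wvec i) = 4 • wvec i).card := by
    let π : Fin 3 ≃ Fin 3 := Equiv.ofBijective (letter W h2)
      (letter_injective W h2).bijective_of_finite
    conv_rhs => rw [← Finset.card_map π.toEmbedding]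
    congr 1
    ext j
    simp only [Finset.mem_map_equiv, Finset.mem_filter, Finset.mem_univ, true_and]
    rw [← permGal_letter_eq_iff, show letter W h2 (π.symm j) = π (π.symm j) from rfl,
      Equiv.apply_symm_apply]
  by_cases hs : sg (M W h2 σ) = 1
  · rw [hs, sgnUnit_one]
    have h1 : Equiv.Perm.sign (permGal W h2 σ) = -1 := by
      rw [sign_eq_neg_one_iff_card, hcard]
      have key := (eps_eq_one_iff_card _ hdet).mp hs
      convert key using 2
      exact Finset.filter_congr fun i _ ↦ four_nsmul_mulVec_eq_iff _ i
    rw [h1]; push_cast; rfl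
  · have hs0 : sg (M W h2 σ) = 0 := by
      rcases (by decide : ∀ z : ZMod 2, z = 0 ∨ z = 1) (sg (M W h2 σ)) with h | h
      · exact h
      · exact absurd h hs
    rw [hs0, sgnUnit_zero]
    have h1 : Equiv.Perm.sign (permGal W h2 σ) ≠ -1 := by
      rw [Ne, sign_eq_neg_one_iff_card, hcard]
      intro hc
      apply hs
      apply (eps_eq_one_iff_card _ hdet).mpr
      convert hc using 2
      exact Finset.filter_congr fun i _ ↦ (four_nsmul_mulVec_eq_iff _ i).symm
    rcases Int.units_eq_one_or (Equiv.Perm.sign (permGal W h2 σ)) with h | h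
    · rw [h]; push_cast; rfl
    · exact absurd h h1

end Literature.NumberTheory.EllipticCurves.DokchitserDokchitser2012

end
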